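import Literature.MathematicalPhysics.QuantumFieldTheory.BalabanImbrieJaffe1984to88.BIJ88SDerivative305

/-!
# `BalabanImbrieJaffe1984to88.BIJ88SDerivativesAllOrders305` — T. Bałaban, J. Imbrie, A. Jaffe, *Effective action and cluster properties of
the abelian Higgs model*, Commun. Math. Phys. **114** (1988) 257–315 [BalabanImbrieJaffe1988], §5.13 p. 305 [PDF 49]: **the parameter
derivatives OF ALL ORDERS of the interpolated Gaussian integrals exist** — the map `P ↦ Z_G(P) = ∫ G(Φ) e^{−½⟨Φ,PΦ⟩} e^{⟨ℱ,Φ⟩} dΦ` is `C^∞`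
in the entries `P` of the precision on the open set of coercive `P`, for every bounded measurable `G` and every linear term `ℱ` (p13's
`BIJ88SDerivative305` is the first derivative in one parameter `s_i` at bounded `G`; the present file gives the Fréchet derivative in all
entries, `∂Z_G/∂P_{xy} = −½Z_{Φ_xΦ_yG}`, and every order by absorbing the pulled-down monomials into the weight). This is the analytic
input making the `∂/∂s_Γ` of the p. 305 expansion honest derivatives of the Gaussian expectations (`BIJ88PolymerRep5134DerivGauss`).

statement-level skeleton of published theorems with citation tags; proofs where landed; nothing here is a claim about the Yang–Mills mass gap

PDF held: `paper:balaban1988-cmp114-bij-abelian-higgs-effective-action` (journal page = PDF page + 256); p. 305 = PDF 49 rendered and read as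
an image this session (p25 seat `renders/original-p049-x2.png`).

**The print (verbatim, p. 305).** *"To give our expansion, we use the fundamental theorem of calculus to write ⟨Π_{i∈I} f(□_i)⟩_1 =
Σ_{Γ⊂I} ∫ds_Γ (∂/∂s_Γ)⟨Π_{i∈I} f(□_i)⟩_{s_Γ}. Here s_Γ specifies s_i = 0 for i ∉ Γ, ds_Γ = Π_{i∈Γ} ds_i, ∂/∂s_Γ = Π_{i∈Γ} d/ds_i, and
⟨·⟩_{s_Γ} is the expectation with quadratic form Δ_{s_Γ} instead of Δ. To calculate the s-derivatives, note that the first derivative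
produces a term ⟨Σ_{j≠i} s_j⟨□_iΦ, Δ□_jΦ⟩; Π_{i∈I} f(□_i)⟩_{s_Γ}. Subsequent derivatives either hit factors s_j already pulled down or
bring new terms down with new truncations."*

**What is proved (0 `sorry`, standard axioms, 0 new `Prop` facts).** `T` a finite type of sites, parameter = the array of entries
`P : T → T → ℝ` (sup norm; fed to the weight as `Matrix.of P`), `weight`/`source` of `B2Eq228Conditioning`.
* §1 `gaussInt ℱ G P := ∫ G φ · weight (Matrix.of P) φ · source ℱ φ`; `IsCoercive P` (`∃ c>0, c‖Φ‖²₂ ≤ ⟨Φ,PΦ⟩`), `coerciveSet`; the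
  quadratic form as a continuous linear functional of the entries `quadCLM` (`quadCLM_apply`, `norm_quadCLM_le`: `‖·‖ ≤ |T|‖Φ‖²₂`);
  `coercive_near` (uniform coercivity `c/2` on the ball of radius `c/(2(|T|+1))`), **`isOpen_coerciveSet`**, `weight_le_of_coercive`.
* §2 `integrable_moment2`, `integrable_gauss`, `gaussInt_one_pos` (the partition function is positive), the derivative integrand `dInt`
  (`hasFDerivAt_integrand`, `norm_dInt_le`), and **`hasFDerivAt_gaussInt`**: at a coercive `P₀`,
  `DZ_G(P₀) = Σ_{x,y} (−½ Z_{Φ_xΦ_yG}(P₀)) dP_{xy}` (`hasFDerivAt_integral_of_dominated_of_fderiv_le`, domination by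
  `K₀·½·|T|‖Φ‖²₂ e^{⟨ℱ,Φ⟩}e^{−(c/4)‖Φ‖²₂}`, p13's `integrable_fieldProd_tilt`).
* §3 `weight_absorb` (`e^{−½⟨Φ,PΦ⟩} = e^{−½⟨Φ,(P−2ε𝟙)Φ⟩}e^{−ε‖Φ‖²}`), `norm_absorbed_le` (`|Φ_xΦ_y e^{−ε‖Φ‖²}G| ≤ K₀/ε`), `gaussInt_absorb`,
  `coercive_shift`, **`contDiffOn_gaussInt_nat`** (induction on `n`: `C^{n+1}` from `C^n` of the `Z_{Φ_xΦ_yG} = Z_{G′}(· − 2ε𝟙)` locally,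
  `contDiffOn_succ_iff_fderiv_of_isOpen`, `contDiffOn_of_locally_contDiffOn`), **`contDiffOn_gaussInt`**: `C^∞` on `coerciveSet`.
* §4 **`isCoercive_of_posDef`**: a positive definite real matrix is coercive (minimum of the form on the compact unit sphere);
  `mem_coerciveSet_of_posDef`.

**Honest scope.** Real fields on finitely many sites; bounded measurable `G` (no growth condition beyond boundedness is needed since the
pulled-down monomials are absorbed); the parameter space is all of `T → T → ℝ` (non-symmetric arrays allowed — only `⟨Φ,PΦ⟩` enters); the
printed pairing/truncation structure of the derivatives (the displayed result on p. 305) is p13's `BIJ88TruncatedPair306` and is not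
re-derived here. NOT summit progress; NOT continuum; NOT Clay. Imports: `BIJ88SDerivative305` only; modifies nothing. Cell `lit-balaban`
Phase 2, seat p25 gen 8; row C2.Eq5.13.3-5.13.4 (owner r16, referee ref-5).
-/

noncomputable section

namespace Literature.MathematicalPhysics.QuantumFieldTheory.BalabanImbrieJaffe1984to88.BIJ88SDerivativesAllOrders305

open MeasureTheory Matrix Finset Filter Function Metric Set
open scoped BigOperators Topology ContDiff
open Literature.MathematicalPhysics.QuantumFieldTheory.Balaban1983to89
open B2Eq228Conditioning (weight source continuous_weight continuous_source weight_pos)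
open BIJ88IntegrationByParts305 (source_eq integrable_tilt integrable_fieldProd_bdd_tilt)

variable {T : Type} [Fintype T]

/-! ## §1 The Gaussian integral as a function of the precision entries; coercive forms

The parameter is the ARRAY of entries `P : T → T → ℝ` (sup norm), fed to the Gaussian weight as the matrix `Matrix.of P`. -/

/-- `Z_G(P) = ∫ G(Φ) e^{−½⟨Φ,PΦ⟩} e^{⟨ℱ,Φ⟩} dΦ` as a function of the entries `P` of the precision. [cite: BalabanImbrieJaffe1988, p.305 (Sect. 5.13)] -/
def gaussInt (f : T → ℝ) (G : (T → ℝ) → ℝ) (P : T → T → ℝ) : ℝ := ∫ φ, G φ * (weight (Matrix.of P) φ * source f φ)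

/-- `P` is coercive: `c‖Φ‖²₂ ≤ ⟨Φ,PΦ⟩` for some `c > 0`. [cite: BalabanImbrieJaffe1988, p.305 (Sect. 5.13)] -/
def IsCoercive (P : T → T → ℝ) : Prop := ∃ c : ℝ, 0 < c ∧ ∀ φ : T → ℝ, c * (φ ⬝ᵥ φ) ≤ φ ⬝ᵥ (Matrix.of P *ᵥ φ)

/-- the set of coercive entry arrays. [cite: BalabanImbrieJaffe1988, p.305 (Sect. 5.13)] -/
def coerciveSet : Set (T → T → ℝ) := {P | IsCoercive P}

/-- membership. [cite: BalabanImbrieJaffe1988, p.305 (Sect. 5.13)] -/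
theorem mem_coerciveSet {P : T → T → ℝ} : P ∈ coerciveSet ↔ IsCoercive P := Iff.rfl

/-- the `(x,y)` entry as a continuous linear functional. [cite: BalabanImbrieJaffe1988, p.305 (Sect. 5.13)] -/
def entryCLM (x y : T) : (T → T → ℝ) →L[ℝ] ℝ :=
  (ContinuousLinearMap.proj (R := ℝ) (φ := fun _ : T => ℝ) y).comp (ContinuousLinearMap.proj (R := ℝ) (φ := fun _ : T => T → ℝ) x)

omit [Fintype T] in
/-- evaluation. [cite: BalabanImbrieJaffe1988, p.305 (Sect. 5.13)] -/
@[simp] theorem entryCLM_apply (x y : T) (H : T → T → ℝ) : entryCLM x y H = H x y := rfl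

/-- the quadratic form `H ↦ ⟨Φ,HΦ⟩` as a continuous linear functional of the entries. [cite: BalabanImbrieJaffe1988, p.305 (Sect. 5.13)] -/
def quadCLM (φ : T → ℝ) : (T → T → ℝ) →L[ℝ] ℝ := ∑ x, ∑ y, (φ x * φ y) • entryCLM x y

/-- evaluation, entrywise. [cite: BalabanImbrieJaffe1988, p.305 (Sect. 5.13)] -/
theorem quadCLM_apply_sum (φ : T → ℝ) (H : T → T → ℝ) : quadCLM φ H = ∑ x, ∑ y, φ x * φ y * H x y := by
  simp only [quadCLM, _root_.sum_apply, _root_.smul_apply, entryCLM_apply, smul_eq_mul]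

/-- evaluation. [cite: BalabanImbrieJaffe1988, p.305 (Sect. 5.13)] -/
theorem quadCLM_apply (φ : T → ℝ) (H : T → T → ℝ) : quadCLM φ H = φ ⬝ᵥ (Matrix.of H *ᵥ φ) := by
  rw [quadCLM_apply_sum]
  simp only [dotProduct, mulVec, Matrix.of_apply, Finset.mul_sum]
  exact Finset.sum_congr rfl fun x _ => Finset.sum_congr rfl fun y _ => by ring

/-- `φ ↦ quadCLM φ` is continuous. [cite: BalabanImbrieJaffe1988, p.305 (Sect. 5.13)] -/
theorem continuous_quadCLM : Continuous fun φ : T → ℝ => quadCLM φ := by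
  unfold quadCLM
  refine continuous_finsetSum _ fun x _ => continuous_finsetSum _ fun y _ => ?_
  exact ((continuous_apply x).mul (continuous_apply y)).smul continuous_const

/-- `Σ_{x,y} |Φ_x||Φ_y| ≤ |T|·‖Φ‖²₂`. [cite: BalabanImbrieJaffe1988, p.305 (Sect. 5.13)] -/
theorem sum_abs_mul_abs_le (φ : T → ℝ) : ∑ x, ∑ y, |φ x| * |φ y| ≤ Fintype.card T * (φ ⬝ᵥ φ) := by
  have h : ∀ x y, |φ x| * |φ y| ≤ (φ x * φ x + φ y * φ y) / 2 := fun x y => by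
    have := two_mul_le_add_sq |φ x| |φ y|
    rw [sq_abs, sq_abs] at this
    nlinarith
  have hrow : ∀ x, ∑ y, (φ x * φ x + φ y * φ y) / 2 = (Fintype.card T * (φ x * φ x) + φ ⬝ᵥ φ) / 2 := by
    intro x
    rw [← Finset.sum_div, Finset.sum_add_distrib, Finset.sum_const, Finset.card_univ, nsmul_eq_mul]
    rfl
  calc ∑ x, ∑ y, |φ x| * |φ y| ≤ ∑ x, ∑ y, (φ x * φ x + φ y * φ y) / 2 :=
        sum_le_sum fun x _ => sum_le_sum fun y _ => h x y
    _ = ∑ x, (Fintype.card T * (φ x * φ x) + φ ⬝ᵥ φ) / 2 := Finset.sum_congr rfl fun x _ => hrow x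
    _ = Fintype.card T * (φ ⬝ᵥ φ) := by
        rw [← Finset.sum_div, Finset.sum_add_distrib, ← Finset.mul_sum, Finset.sum_const, Finset.card_univ, nsmul_eq_mul]
        simp only [dotProduct]
        ring

/-- `‖quadCLM Φ‖ ≤ |T|·‖Φ‖²₂` (sup norm on the entries). [cite: BalabanImbrieJaffe1988, p.305 (Sect. 5.13)] -/
theorem norm_quadCLM_le (φ : T → ℝ) : ‖quadCLM φ‖ ≤ Fintype.card T * (φ ⬝ᵥ φ) := by
  have hn : 0 ≤ φ ⬝ᵥ φ := Finset.sum_nonneg fun x _ => mul_self_nonneg (φ x)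
  refine ContinuousLinearMap.opNorm_le_bound _ (by positivity) fun H => ?_
  rw [Real.norm_eq_abs, quadCLM_apply_sum]
  calc |∑ x, ∑ y, φ x * φ y * H x y|
      ≤ ∑ x, ∑ y, |φ x * φ y * H x y| :=
        (abs_sum_le_sum_abs _ _).trans (sum_le_sum fun x _ => abs_sum_le_sum_abs _ _)
    _ ≤ ∑ x, ∑ y, |φ x| * |φ y| * ‖H‖ := sum_le_sum fun x _ => sum_le_sum fun y _ => by
        rw [abs_mul, abs_mul]
        have h : |H x y| ≤ ‖H‖ := by
          have h1 := norm_le_pi_norm (H x) y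
          have h2 := norm_le_pi_norm H x
          rw [Real.norm_eq_abs] at h1
          exact h1.trans h2
        exact mul_le_mul_of_nonneg_left h (by positivity)
    _ = (∑ x, ∑ y, |φ x| * |φ y|) * ‖H‖ := by simp only [Finset.sum_mul]
    _ ≤ Fintype.card T * (φ ⬝ᵥ φ) * ‖H‖ := mul_le_mul_of_nonneg_right (sum_abs_mul_abs_le φ) (norm_nonneg _)

/-- perturbation of the quadratic form. [cite: BalabanImbrieJaffe1988, p.305 (Sect. 5.13)] -/
theorem abs_quad_sub_le (P P₀ : T → T → ℝ) (φ : T → ℝ) :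
    |φ ⬝ᵥ (Matrix.of (P - P₀) *ᵥ φ)| ≤ ‖P - P₀‖ * (Fintype.card T * (φ ⬝ᵥ φ)) := by
  have h := (quadCLM φ).le_opNorm (P - P₀)
  rw [quadCLM_apply, Real.norm_eq_abs] at h
  calc |φ ⬝ᵥ (Matrix.of (P - P₀) *ᵥ φ)| ≤ ‖quadCLM φ‖ * ‖P - P₀‖ := h
    _ ≤ Fintype.card T * (φ ⬝ᵥ φ) * ‖P - P₀‖ := mul_le_mul_of_nonneg_right (norm_quadCLM_le φ) (norm_nonneg _)
    _ = ‖P - P₀‖ * (Fintype.card T * (φ ⬝ᵥ φ)) := mul_comm _ _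

omit [Fintype T] in
/-- `Matrix.of` is additive (definitional). [cite: BalabanImbrieJaffe1988, p.305 (Sect. 5.13)] -/
theorem of_sub (P P₀ : T → T → ℝ) : Matrix.of (P - P₀) = Matrix.of P - Matrix.of P₀ := rfl

/-- **uniform coercivity near a coercive array**: `‖P − P₀‖ ≤ c/(2(|T|+1))` ⇒ `(c/2)‖Φ‖²₂ ≤ ⟨Φ,PΦ⟩`.
[cite: BalabanImbrieJaffe1988, p.305 (Sect. 5.13)] -/
theorem coercive_near {P₀ : T → T → ℝ} {c : ℝ} (hc : 0 < c) (hcM : ∀ φ : T → ℝ, c * (φ ⬝ᵥ φ) ≤ φ ⬝ᵥ (Matrix.of P₀ *ᵥ φ))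
    {P : T → T → ℝ} (hP : ‖P - P₀‖ ≤ c / (2 * (Fintype.card T + 1))) (φ : T → ℝ) :
    c / 2 * (φ ⬝ᵥ φ) ≤ φ ⬝ᵥ (Matrix.of P *ᵥ φ) := by
  have hsplit : φ ⬝ᵥ (Matrix.of P *ᵥ φ) = φ ⬝ᵥ (Matrix.of P₀ *ᵥ φ) + φ ⬝ᵥ (Matrix.of (P - P₀) *ᵥ φ) := by
    rw [of_sub, Matrix.sub_mulVec, dotProduct_sub]
    ring
  have h1 := hcM φ
  have h2 := abs_quad_sub_le P P₀ φ
  have h3 := neg_abs_le (φ ⬝ᵥ (Matrix.of (P - P₀) *ᵥ φ))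
  have hn : 0 ≤ φ ⬝ᵥ φ := Finset.sum_nonneg fun x _ => mul_self_nonneg (φ x)
  have hk : (0 : ℝ) ≤ Fintype.card T := Nat.cast_nonneg _
  have h4 : ‖P - P₀‖ * (Fintype.card T * (φ ⬝ᵥ φ)) ≤ c / (2 * (Fintype.card T + 1)) * (Fintype.card T * (φ ⬝ᵥ φ)) :=
    mul_le_mul_of_nonneg_right hP (by positivity)
  have h5 : c / (2 * (Fintype.card T + 1)) * (Fintype.card T * (φ ⬝ᵥ φ)) ≤ c / 2 * (φ ⬝ᵥ φ) := by
    have he : c / (2 * (Fintype.card T + 1)) * (Fintype.card T * (φ ⬝ᵥ φ))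
        = c / 2 * (φ ⬝ᵥ φ) * (Fintype.card T / (Fintype.card T + 1)) := by
      field_simp
    rw [he]
    exact mul_le_of_le_one_right (by positivity) ((div_le_one (by positivity)).2 (by linarith))
  linarith

/-- the coercive arrays form an open set. [cite: BalabanImbrieJaffe1988, p.305 (Sect. 5.13)] -/
theorem isOpen_coerciveSet : IsOpen (coerciveSet : Set (T → T → ℝ)) := by
  rw [Metric.isOpen_iff]
  rintro P₀ ⟨c, hc, hcM⟩
  refine ⟨c / (2 * (Fintype.card T + 1)), by positivity, fun P hP => ⟨c / 2, by positivity, fun φ => ?_⟩⟩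
  exact coercive_near hc hcM (mem_ball_iff_norm.1 hP).le φ

variable [DecidableEq T]

/-- the Gaussian weight of a coercive array is dominated by an isotropic Gaussian. [cite: BalabanImbrieJaffe1988, p.305 (Sect. 5.13)] -/
theorem weight_le_of_coercive {P : T → T → ℝ} {c : ℝ} (hcM : ∀ φ : T → ℝ, c * (φ ⬝ᵥ φ) ≤ φ ⬝ᵥ (Matrix.of P *ᵥ φ))
    (φ : T → ℝ) : weight (Matrix.of P) φ ≤ Real.exp (-(1/2 : ℝ) * (φ ⬝ᵥ (c • (1 : Matrix T T ℝ)) *ᵥ φ)) := by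
  rw [B2Eq228Conditioning.weight, Real.exp_le_exp, Matrix.smul_mulVec, Matrix.one_mulVec, dotProduct_smul, smul_eq_mul]
  have := hcM φ
  linarith

/-! ## §2 Differentiability in the entries (dominated differentiation under the integral sign) -/

/-- **moments of order two against a coercive Gaussian weight are integrable** (with a bounded measurable factor).
[cite: BalabanImbrieJaffe1988, p.305 (Sect. 5.13)] -/
theorem integrable_moment2 {P : T → T → ℝ} {c : ℝ} (hc : 0 < c) (hcM : ∀ φ : T → ℝ, c * (φ ⬝ᵥ φ) ≤ φ ⬝ᵥ (Matrix.of P *ᵥ φ))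
    (f : T → ℝ) {G : (T → ℝ) → ℝ} (hGm : AEStronglyMeasurable G volume) {K₀ : ℝ} (hK : ∀ φ, ‖G φ‖ ≤ K₀) (x y : T) :
    Integrable (fun φ : T → ℝ => φ x * φ y * G φ * (weight (Matrix.of P) φ * source f φ)) := by
  have hA : (c • (1 : Matrix T T ℝ)).PosDef := Matrix.PosDef.one.smul hc
  have hK0 : 0 ≤ K₀ := (norm_nonneg _).trans (hK 0)
  have hg := (integrable_fieldProd_bdd_tilt hA (Finset.univ : Finset (Fin 2)) (![Pi.single x (1:ℝ), Pi.single y 1]) f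
    (H := fun _ => K₀) aestronglyMeasurable_const (K := K₀) (fun _ => by rw [Real.norm_eq_abs, abs_of_nonneg hK0])).norm
  refine hg.mono' ?_ (Eventually.of_forall fun φ => ?_)
  · exact ((((continuous_apply x).mul (continuous_apply y)).aestronglyMeasurable.mul hGm).mul
      (((continuous_weight _).mul (continuous_source f)).aestronglyMeasurable))
  · have hw := weight_le_of_coercive hcM φ
    have hw0 := (weight_pos (Matrix.of P) φ).le
    simp only [Fin.prod_univ_two, Matrix.cons_val_zero, Matrix.cons_val_one, dotProduct_single_one,
      source_eq f, norm_mul, Real.norm_eq_abs, abs_of_nonneg hw0, Real.abs_exp, abs_of_nonneg hK0]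
    have hGφ : |G φ| ≤ K₀ := by simpa only [Real.norm_eq_abs] using hK φ
    calc |φ x| * |φ y| * |G φ| * (weight (Matrix.of P) φ * Real.exp (φ ⬝ᵥ f))
        ≤ |φ x| * |φ y| * K₀ * (Real.exp (-(1/2 : ℝ) * (φ ⬝ᵥ (c • (1 : Matrix T T ℝ)) *ᵥ φ)) * Real.exp (φ ⬝ᵥ f)) := by
          gcongr
    _ = |φ x| * |φ y| * K₀ * (Real.exp (φ ⬝ᵥ f) * Real.exp (-(1/2 : ℝ) * (φ ⬝ᵥ (c • (1 : Matrix T T ℝ)) *ᵥ φ))) := by ring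

/-- **the integrand is integrable** against a coercive weight. [cite: BalabanImbrieJaffe1988, p.305 (Sect. 5.13)] -/
theorem integrable_gauss {P : T → T → ℝ} {c : ℝ} (hc : 0 < c) (hcM : ∀ φ : T → ℝ, c * (φ ⬝ᵥ φ) ≤ φ ⬝ᵥ (Matrix.of P *ᵥ φ))
    (f : T → ℝ) {G : (T → ℝ) → ℝ} (hGm : AEStronglyMeasurable G volume) {K₀ : ℝ} (hK : ∀ φ, ‖G φ‖ ≤ K₀) :
    Integrable (fun φ : T → ℝ => G φ * (weight (Matrix.of P) φ * source f φ)) := by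
  have hA : (c • (1 : Matrix T T ℝ)).PosDef := Matrix.PosDef.one.smul hc
  have hK0 : 0 ≤ K₀ := (norm_nonneg _).trans (hK 0)
  refine ((integrable_tilt hA f).const_mul K₀).mono' ?_ (Eventually.of_forall fun φ => ?_)
  · exact hGm.mul (((continuous_weight _).mul (continuous_source f)).aestronglyMeasurable)
  · have hw := weight_le_of_coercive hcM φ
    have hw0 := (weight_pos (Matrix.of P) φ).le
    simp only [source_eq f, norm_mul, Real.norm_eq_abs, abs_of_nonneg hw0, Real.abs_exp]
    have hGφ : |G φ| ≤ K₀ := by simpa only [Real.norm_eq_abs] using hK φ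
    calc |G φ| * (weight (Matrix.of P) φ * Real.exp (φ ⬝ᵥ f))
        ≤ K₀ * (Real.exp (-(1/2 : ℝ) * (φ ⬝ᵥ (c • (1 : Matrix T T ℝ)) *ᵥ φ)) * Real.exp (φ ⬝ᵥ f)) := by gcongr
    _ = K₀ * (Real.exp (φ ⬝ᵥ f) * Real.exp (-(1/2 : ℝ) * (φ ⬝ᵥ (c • (1 : Matrix T T ℝ)) *ᵥ φ))) := by ring


/-- **the partition function of a coercive weight is positive.** [cite: BalabanImbrieJaffe1988, p.305 (Sect. 5.13)] -/
theorem gaussInt_one_pos {P : T → T → ℝ} {c : ℝ} (hc : 0 < c) (hcM : ∀ φ : T → ℝ, c * (φ ⬝ᵥ φ) ≤ φ ⬝ᵥ (Matrix.of P *ᵥ φ))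
    (f : T → ℝ) : 0 < gaussInt f (fun _ => 1) P := by
  have h : ∀ φ : T → ℝ, (1 : ℝ) * (weight (Matrix.of P) φ * source f φ)
      = Real.exp (-(1/2 : ℝ) * (φ ⬝ᵥ Matrix.of P *ᵥ φ) + ∑ x, f x * φ x) := fun φ => by
    rw [one_mul, B2Eq228Conditioning.weight, B2Eq228Conditioning.source, Real.exp_add]
  have hint := integrable_gauss hc hcM f (G := fun _ => (1:ℝ)) aestronglyMeasurable_const (K₀ := 1) (fun _ => by simp)
  unfold gaussInt
  simp_rw [h] at hint ⊢
  exact integral_exp_pos hint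

omit [DecidableEq T] in
/-- the derivative integrand. [cite: BalabanImbrieJaffe1988, p.305 (Sect. 5.13)] -/
def dInt (f : T → ℝ) (G : (T → ℝ) → ℝ) (P : T → T → ℝ) (φ : T → ℝ) : (T → T → ℝ) →L[ℝ] ℝ :=
  G φ • (source f φ • (Real.exp (-(1/2 : ℝ) * quadCLM φ P) • ((-(1/2 : ℝ)) • quadCLM φ)))

omit [DecidableEq T] in
/-- pointwise derivative of the integrand in the entries. [cite: BalabanImbrieJaffe1988, p.305 (Sect. 5.13)] -/
theorem hasFDerivAt_integrand (f : T → ℝ) (G : (T → ℝ) → ℝ) (φ : T → ℝ) (P : T → T → ℝ) :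
    HasFDerivAt (fun P => G φ * (weight (Matrix.of P) φ * source f φ)) (dInt f G P φ) P := by
  have hF : (fun P : T → T → ℝ => G φ * (weight (Matrix.of P) φ * source f φ))
      = fun P => G φ * (Real.exp (-(1/2 : ℝ) * quadCLM φ P) * source f φ) := by
    funext P
    rw [quadCLM_apply]
    rfl
  rw [hF]
  exact ((((quadCLM φ).hasFDerivAt.const_mul (-(1/2 : ℝ))).exp.mul_const (source f φ)).const_mul (G φ))

omit [DecidableEq T] in
/-- norm of the derivative integrand. [cite: BalabanImbrieJaffe1988, p.305 (Sect. 5.13)] -/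
theorem norm_dInt_le (f : T → ℝ) {G : (T → ℝ) → ℝ} {K₀ : ℝ} (hK : ∀ φ, ‖G φ‖ ≤ K₀) (P : T → T → ℝ) (φ : T → ℝ) :
    ‖dInt f G P φ‖ ≤ K₀ * (1/2) * (Fintype.card T * (φ ⬝ᵥ φ)) * (weight (Matrix.of P) φ * Real.exp (φ ⬝ᵥ f)) := by
  have hK0 : 0 ≤ K₀ := (norm_nonneg _).trans (hK 0)
  have hn : 0 ≤ φ ⬝ᵥ φ := Finset.sum_nonneg fun x _ => mul_self_nonneg (φ x)
  have hw : Real.exp (-(1/2 : ℝ) * quadCLM φ P) = weight (Matrix.of P) φ := by rw [quadCLM_apply]; rfl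
  simp only [dInt, norm_smul, Real.norm_eq_abs, hw, abs_of_nonneg (weight_pos (Matrix.of P) φ).le, source_eq f, Real.abs_exp,
    abs_neg, abs_of_nonneg (show (0:ℝ) ≤ 1/2 by norm_num)]
  have hGφ : |G φ| ≤ K₀ := by simpa only [Real.norm_eq_abs] using hK φ
  have hq := norm_quadCLM_le φ
  have hw0 : 0 ≤ weight (Matrix.of P) φ := (weight_pos _ φ).le
  have h2 : weight (Matrix.of P) φ * (1/2 * ‖quadCLM φ‖) ≤ weight (Matrix.of P) φ * (1/2 * (Fintype.card T * (φ ⬝ᵥ φ))) :=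
    mul_le_mul_of_nonneg_left (by linarith) hw0
  calc |G φ| * (Real.exp (φ ⬝ᵥ f) * (weight (Matrix.of P) φ * (1/2 * ‖quadCLM φ‖)))
      ≤ K₀ * (Real.exp (φ ⬝ᵥ f) * (weight (Matrix.of P) φ * (1/2 * (Fintype.card T * (φ ⬝ᵥ φ))))) :=
        mul_le_mul hGφ (mul_le_mul_of_nonneg_left h2 (Real.exp_pos _).le)
          (mul_nonneg (Real.exp_pos _).le (mul_nonneg hw0 (mul_nonneg (by norm_num) (norm_nonneg _)))) hK0
  _ = K₀ * (1/2) * (Fintype.card T * (φ ⬝ᵥ φ)) * (weight (Matrix.of P) φ * Real.exp (φ ⬝ᵥ f)) := by ring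

/-- **the derivative of `Z_G` in the precision entries** (dominated differentiation; p. 305 *"the first derivative produces a term
⟨Σ_{j≠i} s_j⟨□_iΦ, Δ□_jΦ⟩; Π_{i∈I} f(□_i)⟩_{s_Γ}"* — at the level of the entries, `∂Z_G/∂P_{xy} = −½ Z_{Φ_xΦ_yG}`: a derivative in the
precision pulls down the quadratic monomial `Φ_xΦ_y`). [cite: BalabanImbrieJaffe1988, p.305 (Sect. 5.13)] -/
theorem hasFDerivAt_gaussInt {P₀ : T → T → ℝ} {c : ℝ} (hc : 0 < c) (hcM : ∀ φ : T → ℝ, c * (φ ⬝ᵥ φ) ≤ φ ⬝ᵥ (Matrix.of P₀ *ᵥ φ))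
    (f : T → ℝ) {G : (T → ℝ) → ℝ} (hGm : AEStronglyMeasurable G volume) {K₀ : ℝ} (hK : ∀ φ, ‖G φ‖ ≤ K₀) :
    HasFDerivAt (gaussInt f G)
      (∑ x, ∑ y, (-(1/2 : ℝ) * gaussInt f (fun φ => φ x * φ y * G φ) P₀) • entryCLM x y) P₀ := by
  have hK0 : 0 ≤ K₀ := (norm_nonneg _).trans (hK 0)
  set ε : ℝ := c / (2 * (Fintype.card T + 1)) with hε_def
  have hε : 0 < ε := by positivity
  have hA' : ((c / 2) • (1 : Matrix T T ℝ)).PosDef := Matrix.PosDef.one.smul (by positivity)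
  have hnear : ∀ P ∈ ball P₀ ε, ∀ φ : T → ℝ, c / 2 * (φ ⬝ᵥ φ) ≤ φ ⬝ᵥ (Matrix.of P *ᵥ φ) := fun P hP φ =>
    coercive_near hc hcM (mem_ball_iff_norm.1 hP).le φ
  have hF_meas : ∀ᶠ P in 𝓝 P₀, AEStronglyMeasurable (fun φ : T → ℝ => G φ * (weight (Matrix.of P) φ * source f φ)) volume :=
    Eventually.of_forall fun P => hGm.mul (((continuous_weight _).mul (continuous_source f)).aestronglyMeasurable)
  have hF_int : Integrable (fun φ : T → ℝ => G φ * (weight (Matrix.of P₀) φ * source f φ)) :=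
    integrable_gauss hc hcM f hGm hK
  have hF'_meas : AEStronglyMeasurable (fun φ : T → ℝ => dInt f G P₀ φ) volume := by
    have h1 : Continuous fun φ : T → ℝ => (-(1/2 : ℝ)) • quadCLM φ := by
      have := continuous_quadCLM (T := T)
      fun_prop
    have h2 : Continuous fun φ : T → ℝ => Real.exp (-(1/2 : ℝ) * quadCLM φ P₀) :=
      (continuous_const.mul (continuous_quadCLM.clm_apply continuous_const)).rexp
    have h3 : Continuous fun φ : T → ℝ => Real.exp (-(1/2 : ℝ) * quadCLM φ P₀) • ((-(1/2 : ℝ)) • quadCLM φ) := h2.smul h1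
    have h4 : Continuous fun φ : T → ℝ =>
        source f φ • (Real.exp (-(1/2 : ℝ) * quadCLM φ P₀) • ((-(1/2 : ℝ)) • quadCLM φ)) := (continuous_source f).smul h3
    exact hGm.smul h4.aestronglyMeasurable
  -- the dominating function
  have hsq : Integrable fun φ : T → ℝ => (φ ⬝ᵥ φ) *
      (Real.exp (φ ⬝ᵥ f) * Real.exp (-(1/2 : ℝ) * (φ ⬝ᵥ ((c / 2) • (1 : Matrix T T ℝ)) *ᵥ φ))) := by
    have h := integrable_finsetSum (Finset.univ : Finset T) fun x _ =>
      BIJ88IntegrationByParts305.integrable_fieldProd_tilt hA' (Finset.univ : Finset (Fin 2)) (fun _ => Pi.single x (1:ℝ)) f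
    refine h.congr (Eventually.of_forall fun φ => ?_)
    simp only [Fin.prod_univ_two, dotProduct_single_one]
    rw [← Finset.sum_mul]
    simp only [dotProduct]
  have bound_integrable : Integrable fun φ : T → ℝ => K₀ * (1/2) * (Fintype.card T * ((φ ⬝ᵥ φ) *
      (Real.exp (φ ⬝ᵥ f) * Real.exp (-(1/2 : ℝ) * (φ ⬝ᵥ ((c / 2) • (1 : Matrix T T ℝ)) *ᵥ φ))))) :=
    (hsq.const_mul _).const_mul _
  have h_bound : ∀ᵐ φ ∂(volume : Measure (T → ℝ)), ∀ P ∈ ball P₀ ε,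
      ‖dInt f G P φ‖ ≤ K₀ * (1/2) * (Fintype.card T * ((φ ⬝ᵥ φ) *
        (Real.exp (φ ⬝ᵥ f) * Real.exp (-(1/2 : ℝ) * (φ ⬝ᵥ ((c / 2) • (1 : Matrix T T ℝ)) *ᵥ φ))))) := by
    refine Eventually.of_forall fun φ P hP => (norm_dInt_le f hK P φ).trans ?_
    have hw := weight_le_of_coercive (hnear P hP) φ
    have hn : 0 ≤ φ ⬝ᵥ φ := Finset.sum_nonneg fun x _ => mul_self_nonneg (φ x)
    calc K₀ * (1/2) * (Fintype.card T * (φ ⬝ᵥ φ)) * (weight (Matrix.of P) φ * Real.exp (φ ⬝ᵥ f))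
        ≤ K₀ * (1/2) * (Fintype.card T * (φ ⬝ᵥ φ)) *
            (Real.exp (-(1/2 : ℝ) * (φ ⬝ᵥ ((c / 2) • (1 : Matrix T T ℝ)) *ᵥ φ)) * Real.exp (φ ⬝ᵥ f)) := by gcongr
      _ = _ := by ring
  have h_diff : ∀ᵐ φ ∂(volume : Measure (T → ℝ)), ∀ P ∈ ball P₀ ε,
      HasFDerivAt (fun P => G φ * (weight (Matrix.of P) φ * source f φ)) (dInt f G P φ) P :=
    Eventually.of_forall fun φ P _ => hasFDerivAt_integrand f G φ P
  have key := hasFDerivAt_integral_of_dominated_of_fderiv_le (ball_mem_nhds P₀ hε) hF_meas hF_int hF'_meas h_bound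
    bound_integrable h_diff
  have hint' : Integrable (fun φ : T → ℝ => dInt f G P₀ φ) :=
    bound_integrable.mono' hF'_meas (h_bound.mono fun φ h => h P₀ (mem_ball_self hε))
  -- identify the derivative
  have hderiv_eq : (∫ φ : T → ℝ, dInt f G P₀ φ)
      = ∑ x, ∑ y, (-(1/2 : ℝ) * gaussInt f (fun φ => φ x * φ y * G φ) P₀) • entryCLM x y := by
    apply ContinuousLinearMap.ext
    intro H
    rw [ContinuousLinearMap.integral_apply hint' H]
    simp only [_root_.sum_apply, _root_.smul_apply, entryCLM_apply, smul_eq_mul, gaussInt]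
    have hpt : ∀ φ : T → ℝ, dInt f G P₀ φ H
        = ∑ x, ∑ y, -(1/2 : ℝ) * (φ x * φ y * G φ * (weight (Matrix.of P₀) φ * source f φ)) * H x y := by
      intro φ
      have hw : Real.exp (-(1/2 : ℝ) * quadCLM φ P₀) = weight (Matrix.of P₀) φ := by rw [quadCLM_apply]; rfl
      simp only [dInt, _root_.smul_apply, smul_eq_mul]
      rw [hw, quadCLM_apply_sum]
      simp only [Finset.mul_sum]
      exact Finset.sum_congr rfl fun x _ => Finset.sum_congr rfl fun y _ => by ring
    simp_rw [hpt]
    rw [integral_finsetSum _ fun x _ => ?_]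
    · refine Finset.sum_congr rfl fun x _ => ?_
      rw [integral_finsetSum _ fun y _ => ?_]
      · refine Finset.sum_congr rfl fun y _ => ?_
        rw [integral_mul_const, integral_const_mul]
      · exact ((integrable_moment2 hc hcM f hGm hK x y).const_mul _).mul_const _
    · exact integrable_finsetSum _ fun y _ => ((integrable_moment2 hc hcM f hGm hK x y).const_mul _).mul_const _
  rw [← hderiv_eq]
  exact key

/-! ## §3 Smoothness of all orders in the entries: the ε-absorption induction -/

/-- absorbing a small isotropic Gaussian into the weight: `e^{−½⟨Φ,PΦ⟩} = e^{−½⟨Φ,(P−2ε𝟙)Φ⟩}·e^{−ε‖Φ‖²}`.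
[cite: BalabanImbrieJaffe1988, p.305 (Sect. 5.13)] -/
theorem weight_absorb (P : T → T → ℝ) (ε : ℝ) (φ : T → ℝ) :
    weight (Matrix.of P) φ
      = weight (Matrix.of (P - Matrix.of.symm ((2 * ε) • (1 : Matrix T T ℝ)))) φ * Real.exp (-(ε * (φ ⬝ᵥ φ))) := by
  rw [B2Eq228Conditioning.weight, B2Eq228Conditioning.weight, ← Real.exp_add]
  congr 1
  rw [of_sub, Equiv.apply_symm_apply, Matrix.sub_mulVec, dotProduct_sub, Matrix.smul_mulVec, Matrix.one_mulVec, dotProduct_smul,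
    smul_eq_mul]
  ring

/-- `t·e^{−εt} ≤ 1/ε` for `t ≥ 0`, `ε > 0`. [cite: BalabanImbrieJaffe1988, p.305 (Sect. 5.13)] -/
theorem mul_exp_neg_le {ε : ℝ} (hε : 0 < ε) (t : ℝ) : t * Real.exp (-(ε * t)) ≤ 1 / ε := by
  have h1 : ε * t + 1 ≤ Real.exp (ε * t) := Real.add_one_le_exp _
  have h2 : 0 < Real.exp (ε * t) := Real.exp_pos _
  have h3 : Real.exp (-(ε * t)) * Real.exp (ε * t) = 1 := by rw [← Real.exp_add]; simp
  rw [le_div_iff₀ hε]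
  have h4 : 0 ≤ Real.exp (-(ε * t)) := (Real.exp_pos _).le
  nlinarith [mul_le_mul_of_nonneg_left h1 h4]

omit [DecidableEq T] in
/-- the absorbed integrand `Φ_xΦ_y e^{−ε‖Φ‖²} G(Φ)` is bounded by `K₀/ε`. [cite: BalabanImbrieJaffe1988, p.305 (Sect. 5.13)] -/
theorem norm_absorbed_le {G : (T → ℝ) → ℝ} {K₀ : ℝ} (hK : ∀ φ, ‖G φ‖ ≤ K₀) {ε : ℝ} (hε : 0 < ε) (x y : T) (φ : T → ℝ) :
    ‖φ x * φ y * Real.exp (-(ε * (φ ⬝ᵥ φ))) * G φ‖ ≤ 1 / ε * K₀ := by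
  have hK0 : 0 ≤ K₀ := (norm_nonneg _).trans (hK 0)
  have hn : 0 ≤ φ ⬝ᵥ φ := Finset.sum_nonneg fun z _ => mul_self_nonneg (φ z)
  have hx : φ x * φ x ≤ φ ⬝ᵥ φ :=
    Finset.single_le_sum (f := fun z => φ z * φ z) (fun z _ => mul_self_nonneg (φ z)) (Finset.mem_univ x)
  have hy : φ y * φ y ≤ φ ⬝ᵥ φ :=
    Finset.single_le_sum (f := fun z => φ z * φ z) (fun z _ => mul_self_nonneg (φ z)) (Finset.mem_univ y)
  have hxy : |φ x * φ y| ≤ φ ⬝ᵥ φ := by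
    rw [abs_mul]
    have := two_mul_le_add_sq |φ x| |φ y|
    rw [sq_abs, sq_abs] at this
    nlinarith [abs_nonneg (φ x), abs_nonneg (φ y)]
  have hexp := mul_exp_neg_le hε (φ ⬝ᵥ φ)
  have hGφ : |G φ| ≤ K₀ := by simpa only [Real.norm_eq_abs] using hK φ
  rw [Real.norm_eq_abs, abs_mul, abs_mul, Real.abs_exp]
  calc |φ x * φ y| * Real.exp (-(ε * (φ ⬝ᵥ φ))) * |G φ|
      ≤ (φ ⬝ᵥ φ) * Real.exp (-(ε * (φ ⬝ᵥ φ))) * K₀ := by gcongr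
    _ ≤ 1 / ε * K₀ := mul_le_mul_of_nonneg_right hexp hK0

/-- **`Z_{Φ_xΦ_yG}(P) = Z_{G′}(P − 2ε𝟙)`**, `G′ = Φ_xΦ_y e^{−ε‖Φ‖²}G` bounded. [cite: BalabanImbrieJaffe1988, p.305 (Sect. 5.13)] -/
theorem gaussInt_absorb (f : T → ℝ) (G : (T → ℝ) → ℝ) (x y : T) (ε : ℝ) (P : T → T → ℝ) :
    gaussInt f (fun φ => φ x * φ y * G φ) P
      = gaussInt f (fun φ => φ x * φ y * Real.exp (-(ε * (φ ⬝ᵥ φ))) * G φ)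
          (P - Matrix.of.symm ((2 * ε) • (1 : Matrix T T ℝ))) := by
  unfold gaussInt
  refine integral_congr_ae (Eventually.of_forall fun φ => ?_)
  simp only [weight_absorb P ε φ]
  ring

/-- the shifted array `P − 2ε𝟙` is coercive with constant `c − 2ε`. [cite: BalabanImbrieJaffe1988, p.305 (Sect. 5.13)] -/
theorem coercive_shift {P : T → T → ℝ} {c : ℝ} (hcM : ∀ φ : T → ℝ, c * (φ ⬝ᵥ φ) ≤ φ ⬝ᵥ (Matrix.of P *ᵥ φ)) (ε : ℝ)
    (φ : T → ℝ) : (c - 2 * ε) * (φ ⬝ᵥ φ) ≤ φ ⬝ᵥ (Matrix.of (P - Matrix.of.symm ((2 * ε) • (1 : Matrix T T ℝ))) *ᵥ φ) := by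
  rw [of_sub, Equiv.apply_symm_apply, Matrix.sub_mulVec, dotProduct_sub, Matrix.smul_mulVec, Matrix.one_mulVec, dotProduct_smul,
    smul_eq_mul]
  have := hcM φ
  linarith

/-- **`Z_G` is `C^n` in the entries on the coercive set, every `n`** (induction: the derivative is `Σ_{xy} −½Z_{Φ_xΦ_yG}·dP_{xy}` and
`Z_{Φ_xΦ_yG} = Z_{G′}(· − 2ε𝟙)` with `G′` bounded — p. 305: *"Subsequent derivatives either hit factors s_j already pulled down or bring
new terms down with new truncations"*). [cite: BalabanImbrieJaffe1988, p.305 (Sect. 5.13)] -/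
theorem contDiffOn_gaussInt_nat (f : T → ℝ) : ∀ (n : ℕ) (G : (T → ℝ) → ℝ), AEStronglyMeasurable G volume →
    (∃ K₀ : ℝ, ∀ φ, ‖G φ‖ ≤ K₀) → ContDiffOn ℝ n (gaussInt f G) coerciveSet
  | 0 => by
      rintro G hGm ⟨K₀, hK⟩
      rw [Nat.cast_zero, contDiffOn_zero]
      rintro P ⟨c, hc, hcM⟩
      exact (hasFDerivAt_gaussInt hc hcM f hGm hK).continuousAt.continuousWithinAt
  | (n + 1) => by
      rintro G hGm ⟨K₀, hK⟩
      rw [Nat.cast_succ, contDiffOn_succ_iff_fderiv_of_isOpen isOpen_coerciveSet]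
      refine ⟨fun P ⟨c, hc, hcM⟩ => (hasFDerivAt_gaussInt hc hcM f hGm hK).differentiableAt.differentiableWithinAt,
        fun h => absurd h (WithTop.natCast_ne_top n), ?_⟩
      have hfd : ∀ P ∈ (coerciveSet : Set (T → T → ℝ)), fderiv ℝ (gaussInt f G) P
          = ∑ x, ∑ y, (-(1/2 : ℝ) * gaussInt f (fun φ => φ x * φ y * G φ) P) • entryCLM x y :=
        fun P ⟨c, hc, hcM⟩ => (hasFDerivAt_gaussInt hc hcM f hGm hK).fderiv
      refine ContDiffOn.congr ?_ hfd
      refine ContDiffOn.sum fun x _ => ContDiffOn.sum fun y _ => ?_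
      suffices hxy : ContDiffOn ℝ n (gaussInt f (fun φ => φ x * φ y * G φ)) coerciveSet by
        have h1 : ContDiffOn ℝ n (fun P => -(1/2 : ℝ) * gaussInt f (fun φ => φ x * φ y * G φ) P) coerciveSet :=
          contDiffOn_const.mul hxy
        have h2 : ContDiffOn ℝ n (fun _ : T → T → ℝ => entryCLM x y) coerciveSet := contDiffOn_const
        exact h1.smul h2
      -- `P ↦ Z_{Φ_xΦ_yG}(P)` is `C^n` on the coercive set: locally it is `Z_{G′}(P − 2ε𝟙)`
      refine contDiffOn_of_locally_contDiffOn fun P₁ ⟨c₁, hc₁, hcM₁⟩ => ?_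
      set ε : ℝ := c₁ / 4 with hε
      have hεpos : 0 < ε := by positivity
      set sh : (T → T → ℝ) → (T → T → ℝ) := fun P => P - Matrix.of.symm ((2 * ε) • (1 : Matrix T T ℝ)) with hsh
      have hshc : Continuous sh := continuous_id.sub continuous_const
      refine ⟨sh ⁻¹' coerciveSet, isOpen_coerciveSet.preimage hshc, ?_, ?_⟩
      · refine ⟨c₁ - 2 * ε, by rw [hε]; linarith, fun φ => coercive_shift hcM₁ ε φ⟩
      · have hG'm : AEStronglyMeasurable (fun φ : T → ℝ => φ x * φ y * Real.exp (-(ε * (φ ⬝ᵥ φ))) * G φ) volume := by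
          refine (Continuous.aestronglyMeasurable ?_).mul hGm
          exact ((continuous_apply x).mul (continuous_apply y)).mul
            (continuous_const.mul (continuous_id.dotProduct continuous_id)).neg.rexp
        have IH := contDiffOn_gaussInt_nat f n _ hG'm ⟨1 / ε * K₀, norm_absorbed_le hK hεpos x y⟩
        have hcomp : ContDiffOn ℝ n (fun P => gaussInt f (fun φ => φ x * φ y * Real.exp (-(ε * (φ ⬝ᵥ φ))) * G φ) (sh P))
            (sh ⁻¹' coerciveSet) :=
          IH.comp (contDiffOn_id.sub contDiffOn_const) fun P hP => hP
        refine (hcomp.mono Set.inter_subset_right).congr fun P _ => ?_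
        exact gaussInt_absorb f G x y ε P

/-- **`Z_G` is `C^∞` in the precision entries on the coercive set** (`G` bounded measurable, any linear term).
[cite: BalabanImbrieJaffe1988, p.305 (Sect. 5.13)] -/
theorem contDiffOn_gaussInt (f : T → ℝ) {G : (T → ℝ) → ℝ} (hGm : AEStronglyMeasurable G volume) {K₀ : ℝ}
    (hK : ∀ φ, ‖G φ‖ ≤ K₀) : ContDiffOn ℝ ∞ (gaussInt f G) coerciveSet :=
  contDiffOn_infty.2 fun n => contDiffOn_gaussInt_nat f n G hGm ⟨K₀, hK⟩

/-! ## §4 Positive definite matrices are coercive -/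

omit [DecidableEq T] in
/-- **a positive definite real matrix is coercive**: `∃ c > 0, c‖Φ‖²₂ ≤ ⟨Φ,MΦ⟩` (minimum of the form on the compact unit sphere).
[cite: BalabanImbrieJaffe1988, p.305 (Sect. 5.13)] -/
theorem isCoercive_of_posDef {M : Matrix T T ℝ} (hM : M.PosDef) : IsCoercive (Matrix.of.symm M) := by
  rw [IsCoercive, Equiv.apply_symm_apply]
  rcases isEmpty_or_nonempty T with hT | hT
  · refine ⟨1, one_pos, fun φ => ?_⟩
    simp [dotProduct]
  have hS : IsCompact (Metric.sphere (0 : T → ℝ) 1) := isCompact_sphere 0 1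
  have hne : (Metric.sphere (0 : T → ℝ) 1).Nonempty :=
    ⟨fun _ => 1, by rw [mem_sphere_zero_iff_norm, pi_norm_const, norm_one]⟩
  have hcont : Continuous fun φ : T → ℝ => φ ⬝ᵥ (M *ᵥ φ) :=
    continuous_id.dotProduct (continuous_const.matrix_mulVec continuous_id)
  obtain ⟨φ₀, hφ₀S, hmin⟩ := hS.exists_isMinOn hne hcont.continuousOn
  set m := φ₀ ⬝ᵥ (M *ᵥ φ₀) with hm_def
  have hφ₀ne : φ₀ ≠ 0 := by
    intro h
    rw [h, mem_sphere_zero_iff_norm, norm_zero] at hφ₀S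
    exact zero_ne_one hφ₀S
  have hm : 0 < m := by
    have := (Matrix.posDef_iff_dotProduct_mulVec.1 hM).2 hφ₀ne
    simpa only [star_trivial] using this
  have hcard : (0 : ℝ) < Fintype.card T := Nat.cast_pos.2 Fintype.card_pos
  refine ⟨m / Fintype.card T, div_pos hm hcard, fun φ => ?_⟩
  by_cases hφ : φ = 0
  · subst hφ
    simp
  set r := ‖φ‖ with hr_def
  have hr : 0 < r := norm_pos_iff.2 hφ
  have hu : r⁻¹ • φ ∈ Metric.sphere (0 : T → ℝ) 1 := by
    rw [mem_sphere_zero_iff_norm, norm_smul, norm_inv, norm_norm, inv_mul_cancel₀ hr.ne']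
  have h1 : m ≤ (r⁻¹ • φ) ⬝ᵥ (M *ᵥ (r⁻¹ • φ)) := hmin hu
  have h2 : (r⁻¹ • φ) ⬝ᵥ (M *ᵥ (r⁻¹ • φ)) = r⁻¹ * r⁻¹ * (φ ⬝ᵥ (M *ᵥ φ)) := by
    rw [Matrix.mulVec_smul, dotProduct_smul, smul_dotProduct, smul_eq_mul, smul_eq_mul]
    ring
  have h3 : φ ⬝ᵥ φ ≤ Fintype.card T * r ^ 2 := by
    calc φ ⬝ᵥ φ = ∑ x, φ x * φ x := rfl
      _ ≤ ∑ _x : T, r ^ 2 := Finset.sum_le_sum fun x _ => by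
          have hx : |φ x| ≤ r := by
            have := norm_le_pi_norm φ x
            rwa [Real.norm_eq_abs] at this
          have := sq_abs (φ x)
          nlinarith [abs_nonneg (φ x)]
      _ = Fintype.card T * r ^ 2 := by simp
  have h4 : m * r ^ 2 ≤ φ ⬝ᵥ (M *ᵥ φ) := by
    rw [h2] at h1
    have h5 := mul_le_mul_of_nonneg_right h1 (sq_nonneg r)
    have h6 : r⁻¹ * r⁻¹ * (φ ⬝ᵥ (M *ᵥ φ)) * r ^ 2 = φ ⬝ᵥ (M *ᵥ φ) := by
      field_simp
    linarith
  calc m / Fintype.card T * (φ ⬝ᵥ φ) ≤ m / Fintype.card T * (Fintype.card T * r ^ 2) :=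
      mul_le_mul_of_nonneg_left h3 (div_pos hm hcard).le
    _ = m * r ^ 2 := by field_simp
    _ ≤ φ ⬝ᵥ (M *ᵥ φ) := h4

omit [DecidableEq T] in
/-- a positive definite matrix lies in the coercive set. [cite: BalabanImbrieJaffe1988, p.305 (Sect. 5.13)] -/
theorem mem_coerciveSet_of_posDef {M : Matrix T T ℝ} (hM : M.PosDef) : Matrix.of.symm M ∈ coerciveSet :=
  isCoercive_of_posDef hM

end Literature.MathematicalPhysics.QuantumFieldTheory.BalabanImbrieJaffe1984to88.BIJ88SDerivativesAllOrders305

end
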